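import Mathlib.NumberTheory.NumberField.Units.DirichletTheorem
import Mathlib.NumberTheory.NumberField.Cyclotomic.Basic
import Mathlib.NumberTheory.NumberField.Cyclotomic.Embeddings
import Literature.NumberTheory.NumberFields.IdealPowerOfUnramifiedRoot
import Literature.NumberTheory.NumberFields.CyclotomicFieldFourClassNumber
import HarnessLib

/-!
# `K(∅, n) = 1` for `ℚ(i)` and odd `n`: an algebraic integer of a principal number field of unit rank
# zero all of whose prime exponents are divisible by `n`, `gcd(n, w_K) = 1`, is an `n`-th power

PROOF-ONLY file (theorems only, no definition, no named fact, no `sorry`), topic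
`NumberTheory/NumberFields`.  The group `K(S, n) = {x ∈ Kˣ/Kˣⁿ : n ∣ v(x) ∀ v ∉ S}` of an `n`-descent
(Silverman, *AEC*, Prop. VIII.1.6 and X.1.1(c)) sits in `0 → 𝓞_{K,S}ˣ/n → K(S, n) → Cl(𝓞_{K,S})[n]`;
this file proves the case that makes it as small as over `ℚ`: when `𝓞_K` is principal, the unit rank
`r₁ + r₂ − 1` is `0` and `n` is prime to the number `w_K` of roots of unity, `K(∅, n)` is trivial,
i.e. **`n ∣ v(a)` for every finite `v` ⟹ `a = gⁿ`** (for `K = ℚ`, `n` odd, this is the tree's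
`X1Eleven.exists_eq_pow_of_forall_dvd_padicValRat`).  The target is `K = ℚ(i) = ℚ(ζ₄)` (`𝓞_K = ℤ[i]`
principal — tree `isPrincipalIdealRing_ringOfIntegers_of_isCyclotomicExtension_four` —, unit rank `0`,
`w = 4`) and `n = 5`: the `μ₅`-side box of the `5`-descent on `E_{m,n} ⊗ ℚ(i)`
(`KubertTateFiveSelmerTameGaussian` is the `ℤ/5`-side) injects `Sel^{φ̂}` into `⊕_{𝔭 ∣ mn} ℤ/5` by the
exponents at the Gaussian primes of `mn`, the kernel being `K(∅, 5) = 1`.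

* §1 `exists_unit_mul_pow_of_forall_count_dvd` — `𝓞_K` principal, `a ≠ 0`, `n ∣ v(a)` for all `v`
  ⟹ `a = u·gⁿ`, `u` a unit (tree `exists_span_eq_pow_of_forall_count_dvd`: `(a) = 𝔞ⁿ`, `𝔞 = (g)`).
* §2 `mem_torsion_of_rank_eq_zero` (Dirichlet: unit rank `0` ⟹ every unit is a root of unity),
  `exists_eq_pow_of_coprime_torsionOrder` (`gcd(n, w_K) = 1` ⟹ every unit is an `n`-th power),
  **`exists_eq_pow_of_forall_count_dvd_of_rank_eq_zero`** (the three hypotheses together ⟹ `a = gⁿ`).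
* §3 `ℚ(ζ₄)`: `rank_eq_zero_of_isCyclotomicExtension_four`, `torsionOrder_eq_four`,
  **`exists_eq_pow_of_forall_count_dvd_four`** (`n` odd ⟹ `a = gⁿ` in `ℤ[i]`) and the field form
  **`exists_eq_pow_of_forall_dvd_log_valuation_four`** (`x ∈ ℚ(i)ˣ`, `n ∣ v(x)` for all finite `v`
  ⟹ `x = yⁿ`).

## References

* [SilvermanAEC2009] J. H. Silverman, *The Arithmetic of Elliptic Curves*, 2nd ed., Prop. VIII.1.6,
  Thm. X.1.1(c).
* [NeukirchANT1999] J. Neukirch, *Algebraic Number Theory*, Ch. I §7 Thm. (7.4) (Dirichlet's unit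
  theorem), Ch. I §3 (unique factorisation of ideals).
* [Washington1997] L. C. Washington, *Introduction to Cyclotomic Fields*, 2nd ed., Prop. 2.x /
  Lemma 1.6 (roots of unity of `ℚ(ζ_n)`: `μ_n` for even `n`).
-/

noncomputable section

open NumberField NumberField.Units NumberField.InfinitePlace IsDedekindDomain Ideal

namespace Literature.NumberTheory.NumberFields

section General

variable {K : Type*} [Field K] [NumberField K]

/-! ## §1 Principal ring of integers: `n ∣ v(a)` for all `v` ⟹ `a = u·gⁿ` -/

/-- **`(a) = 𝔞ⁿ` with `𝓞_K` principal ⟹ `a = u·gⁿ`.** If every prime exponent of the nonzero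
algebraic integer `a` is divisible by `n` and `𝓞_K` is a principal ideal domain, then `a` is a unit
times an `n`-th power. [cite: SilvermanAEC2009, Prop. VIII.1.6 (proof)] [cite: NeukirchANT1999, Ch. I §3] -/
theorem exists_unit_mul_pow_of_forall_count_dvd [IsPrincipalIdealRing (𝓞 K)] {a : 𝓞 K} (ha : a ≠ 0)
    {n : ℕ} (hdvd : ∀ v : HeightOneSpectrum (𝓞 K),
      n ∣ (Associates.mk v.asIdeal).count (Associates.mk (Ideal.span {a})).factors) :
    ∃ (u : (𝓞 K)ˣ) (g : 𝓞 K), a = u * g ^ n := by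
  obtain ⟨𝔞, h𝔞⟩ := exists_span_eq_pow_of_forall_count_dvd ha hdvd
  obtain ⟨g, hg⟩ := (IsPrincipalIdealRing.principal 𝔞).principal
  rw [hg, Ideal.submodule_span_eq, Ideal.span_singleton_pow, Ideal.span_singleton_eq_span_singleton] at h𝔞
  obtain ⟨u, hu⟩ := h𝔞.symm
  exact ⟨u, g, by rw [← hu, mul_comm]⟩

/-! ## §2 Unit rank zero and `gcd(n, w_K) = 1`: every unit is an `n`-th power -/

/-- **Dirichlet: if the unit rank `r₁ + r₂ − 1` is `0`, every unit is a root of unity.**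
[cite: NeukirchANT1999, Ch. I §7 Thm. (7.4)] -/
theorem mem_torsion_of_rank_eq_zero (hrank : rank K = 0) (u : (𝓞 K)ˣ) : u ∈ torsion K := by
  obtain ⟨⟨x, e⟩, hxu, -⟩ := exist_unique_eq_mul_prod _ u
  have hu : u = x := by
    rw [← mul_one x.1, hxu]
    apply congr_arg
    rw [← Finset.prod_empty]
    congr
    rw [Finset.univ_eq_empty_iff, hrank]
    infer_instance
  rw [hu]; exact x.2

/-- **Unit rank `0` and `gcd(n, w_K) = 1` ⟹ every unit is an `n`-th power** (`w_K = #μ(K)`, Mathlib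
`torsionOrder`; raising to the `n`-th power is a bijection of the cyclic group `μ(K)`).
[cite: NeukirchANT1999, Ch. I §7 Thm. (7.4)] -/
theorem exists_eq_pow_of_coprime_torsionOrder (hrank : rank K = 0) {n : ℕ}
    (hn : (torsionOrder K).Coprime n) (u : (𝓞 K)ˣ) : ∃ w : (𝓞 K)ˣ, u = w ^ n := by
  have hu : u ∈ torsion K := mem_torsion_of_rank_eq_zero hrank u
  obtain ⟨w, hw⟩ := (powCoprime (G := torsion K) hn).surjective ⟨u, hu⟩
  refine ⟨(w : (𝓞 K)ˣ), ?_⟩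
  have h := congrArg (fun t : torsion K => (t : (𝓞 K)ˣ)) hw
  simpa [powCoprime] using h.symm

/-- **`K(∅, n) = 1`**: if `𝓞_K` is principal, the unit rank is `0` and `gcd(n, w_K) = 1`, then a
nonzero algebraic integer all of whose prime exponents are divisible by `n` is an `n`-th power in `𝓞_K`.
[cite: SilvermanAEC2009, Prop. VIII.1.6] [cite: NeukirchANT1999, Ch. I §7 Thm. (7.4)] -/
theorem exists_eq_pow_of_forall_count_dvd_of_rank_eq_zero [IsPrincipalIdealRing (𝓞 K)]
    (hrank : rank K = 0) {n : ℕ}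
    (hn : (torsionOrder K).Coprime n) {a : 𝓞 K} (ha : a ≠ 0)
    (hdvd : ∀ v : HeightOneSpectrum (𝓞 K),
      n ∣ (Associates.mk v.asIdeal).count (Associates.mk (Ideal.span {a})).factors) :
    ∃ g : 𝓞 K, a = g ^ n := by
  obtain ⟨u, g, h⟩ := exists_unit_mul_pow_of_forall_count_dvd ha hdvd
  obtain ⟨w, hw⟩ := exists_eq_pow_of_coprime_torsionOrder hrank hn u
  refine ⟨(w : 𝓞 K) * g, ?_⟩
  rw [h, hw, mul_pow, Units.val_pow_eq_pow_val]

end General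

/-! ## §3 The Gaussian field `ℚ(i) = ℚ(ζ₄)` -/

section Four

variable {K : Type} [Field K] [NumberField K] [IsCyclotomicExtension {4} ℚ K]

/-- `ℚ(ζ₄)` has unit rank `r₁ + r₂ − 1 = 0 + 1 − 1 = 0`. [cite: NeukirchANT1999, Ch. I §7 Thm. (7.4)] -/
theorem rank_eq_zero_of_isCyclotomicExtension_four : rank K = 0 := by
  dsimp only [rank]
  rw [card_eq_nrRealPlaces_add_nrComplexPlaces,
    IsCyclotomicExtension.Rat.nrRealPlaces_eq_zero (n := 4) K (by decide), zero_add,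
    IsCyclotomicExtension.Rat.nrComplexPlaces_eq_totient_div_two (n := 4)]
  rfl

/-- `w_{ℚ(ζ₄)} = #μ(ℚ(i)) = 4`. [cite: Washington1997, Ch. 1 (roots of unity in ℚ(ζ_n))] -/
theorem torsionOrder_eq_four : torsionOrder K = 4 := by
  rw [IsCyclotomicExtension.Rat.torsionOrder_eq (n := 4) (K := K)]
  decide

/-- **`ℚ(i)(∅, n) = 1` for odd `n`**: a nonzero Gaussian integer (element of `𝓞_{ℚ(ζ₄)} = ℤ[i]`) all
of whose prime exponents are divisible by the odd number `n` is an `n`-th power in `ℤ[i]`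
(`ℤ[i]` principal, units `±1, ±i` of order `4` prime to `n`). [cite: SilvermanAEC2009, Prop. VIII.1.6]
[cite: NeukirchANT1999, Ch. I §7 Thm. (7.4)] -/
theorem exists_eq_pow_of_forall_count_dvd_four {n : ℕ} (hn : Odd n) {a : 𝓞 K} (ha : a ≠ 0)
    (hdvd : ∀ v : HeightOneSpectrum (𝓞 K),
      n ∣ (Associates.mk v.asIdeal).count (Associates.mk (Ideal.span {a})).factors) :
    ∃ g : 𝓞 K, a = g ^ n := by
  haveI : IsPrincipalIdealRing (𝓞 K) :=
    isPrincipalIdealRing_ringOfIntegers_of_isCyclotomicExtension_four K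
  refine exists_eq_pow_of_forall_count_dvd_of_rank_eq_zero
    rank_eq_zero_of_isCyclotomicExtension_four ?_ ha hdvd
  rw [torsionOrder_eq_four]
  have h2 : Nat.Coprime 2 n := (Nat.coprime_two_left).mpr hn
  have : Nat.Coprime (2 ^ 2) n := Nat.Coprime.pow_left 2 h2
  simpa using this

/-- **`ℚ(i)(∅, n) = 1`, field form**: a nonzero `x ∈ ℚ(i)` whose valuation at every finite place is
divisible by the odd number `n` (`n ∣ v(x)` for all `v`) is an `n`-th power in `ℚ(i)` — write
`x = a/b` with `a, b ∈ ℤ[i]`, then `a bⁿ⁻¹` has all prime exponents divisible by `n`.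
[cite: SilvermanAEC2009, Prop. VIII.1.6 and Thm. X.1.1(c)] -/
theorem exists_eq_pow_of_forall_dvd_log_valuation_four {n : ℕ} (hn : Odd n) {x : K} (hx : x ≠ 0)
    (hdvd : ∀ v : HeightOneSpectrum (𝓞 K), (n : ℤ) ∣ WithZero.log (v.valuation K x)) :
    ∃ y : K, x = y ^ n := by
  have hn0 : n ≠ 0 := by rintro rfl; exact Nat.not_odd_zero hn
  obtain ⟨a, b, hb, hab⟩ := IsFractionRing.div_surjective (A := 𝓞 K) x
  have hb0 : (b : 𝓞 K) ≠ 0 := nonZeroDivisors.ne_zero hb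
  have hbK : (algebraMap (𝓞 K) K b) ≠ 0 :=
    fun h ↦ hb0 ((FaithfulSMul.algebraMap_injective (𝓞 K) K) (by rw [h, map_zero]))
  have ha0 : a ≠ 0 := by
    rintro rfl
    rw [map_zero, zero_div] at hab
    exact hx hab.symm
  set c : 𝓞 K := a * b ^ (n - 1) with hc
  have hc0 : c ≠ 0 := mul_ne_zero ha0 (pow_ne_zero _ hb0)
  have hcK : algebraMap (𝓞 K) K c = x * (algebraMap (𝓞 K) K b) ^ n := by
    rw [hc, map_mul, map_pow, ← hab]
    obtain ⟨k, hk⟩ := Nat.exists_eq_succ_of_ne_zero hn0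
    rw [hk, Nat.succ_sub_one, pow_succ]
    field_simp
  -- every prime exponent of `c` is divisible by `n`
  have hcdvd : ∀ v : HeightOneSpectrum (𝓞 K),
      n ∣ (Associates.mk v.asIdeal).count (Associates.mk (Ideal.span {c})).factors := by
    intro v
    have hvx : v.valuation K x ≠ 0 := (Valuation.ne_zero_iff _).mpr hx
    have hvb : v.valuation K (algebraMap (𝓞 K) K b) ≠ 0 := (Valuation.ne_zero_iff _).mpr hbK
    have h1 : WithZero.log (v.valuation K (algebraMap (𝓞 K) K c)) =
        WithZero.log (v.valuation K x) + n • WithZero.log (v.valuation K (algebraMap (𝓞 K) K b)) := by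
      rw [hcK, map_mul, map_pow, WithZero.log_mul hvx (pow_ne_zero _ hvb), WithZero.log_pow]
    have h2 : WithZero.log (v.valuation K (algebraMap (𝓞 K) K c)) =
        -((Associates.mk v.asIdeal).count (Associates.mk (Ideal.span {c})).factors : ℤ) := by
      rw [HeightOneSpectrum.valuation_of_algebraMap, HeightOneSpectrum.intValuation_if_neg _ hc0,
        WithZero.log_exp]
    obtain ⟨k, hk⟩ := hdvd v
    have h3 : ((Associates.mk v.asIdeal).count (Associates.mk (Ideal.span {c})).factors : ℤ) =
        (n : ℤ) * (-k - WithZero.log (v.valuation K (algebraMap (𝓞 K) K b))) := by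
      have := h2.symm.trans h1
      rw [hk, nsmul_eq_mul] at this
      linarith
    have h4 : (n : ℤ) ∣ ((Associates.mk v.asIdeal).count (Associates.mk (Ideal.span {c})).factors : ℤ) :=
      ⟨_, h3⟩
    exact Int.natCast_dvd_natCast.mp h4
  obtain ⟨g, hg⟩ := exists_eq_pow_of_forall_count_dvd_four hn hc0 hcdvd
  refine ⟨algebraMap (𝓞 K) K g / algebraMap (𝓞 K) K b, ?_⟩
  rw [div_pow, ← map_pow, ← hg, hcK, mul_div_assoc, div_self (pow_ne_zero _ hbK), mul_one]

end Four

end Literature.NumberTheory.NumberFields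

end
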